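import Summits.MatrixMultiplication.MatrixMultiplication.Statement
import Summits.MatrixMultiplication.MatrixMultiplication.Theorems.FarEdgeDescentSignStarSRank
import Summits.MatrixMultiplication.MatrixMultiplication.Theorems.FarEdgeDescentWeightFamily
import Literature.Computability.AlgebraicComplexity.SupportRankProofs
import Literature.Computability.AlgebraicComplexity.SupportRankWeightRemoval
import Literature.Computability.AlgebraicComplexity.AsymptoticRankMatMul
import Literature.Computability.AlgebraicComplexity.TensorRestrictionRank
import Literature.Barriers.MatrixMultiplication.UniversalMethodBarrierAsymptoticRank
import HarnessLib

/-!
# The same-support stratum of `⟨n,n,n⟩` carries the summit: `ω = 2 ⟺ some tensor with the support of ⟨n,n,n⟩ has asymptotic rank ≤ n²`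

Route `FarEdgeDescent` (cell `decomp-mm`, lens 2 «structural dichotomy (special vs generic)»,
gen 33), Kernel VIII-a — the CONSUMER of Kernel VII's stratum cartography; support for the aside
`SubLogRate` (stmt-MatrixMultiplication-25371).

Kernel VII classified the same-support stratum of `⟨2,2,2⟩` in the two-leaf coordinates of this
route: the special member `𝔖^1 ≅ ⟨2,2,2⟩` and the generic members `𝔖^w` (non-trivial cocycle,
e.g. the sign star `𝔖^♭ = 𝔖^{sgn}` and the family `𝔖(q)`, `q ∉ {0,1}`), pairwise
degeneration-incomparable at every Kronecker level and indistinguishable by every quantum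
functional.  This file states what the stratum is FOR: by Cohn–Umans weight removal
(`ω ≤ (3ω_s − 2)/2`, CU13 Thm. 6, PROVED in the tree as `CohnUmans2013_thm_6_holds`, with
CU13 Prop. 5 `CohnUmans2013_prop_5_holds`) the asymptotic rank of ANY member decides `ω`:

* `omega_le_of_sameSupport_pow_rank_le` — if `supp t = supp ⟨n,n,n⟩` (`n ≥ 2`) and
  `R(t^{⊠N}) ≤ (n^N)^{2+ε}` for one `N ≥ 1`, then `ω ≤ 2 + 3ε/2` (the power `t^{⊠N}` has the
  support of `⟨n^N,n^N,n^N⟩`: `sameSupport_powMM`);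
* `omega_le_of_sameSupport_asymptoticRank_le` — `supp t = supp ⟨n,n,n⟩`, `R̃(t) ≤ n^τ` ⟹
  `ω ≤ (3τ − 2)/2`; in particular (`τ = 2`)
  `summit_of_sameSupport_asymptoticRank_le_sq` — **`R̃(t) ≤ n² ⟹ ω = 2`** — and the converse
  reading `sq_lt_asymptoticRank_of_not_summit` — **`ω > 2 ⟹ R̃(t) > n²` for EVERY tensor `t` with
  the support of `⟨n,n,n⟩`, every `n ≥ 2`**: if `ω > 2` then Strassen's asymptotic rank conjecture
  fails on the whole (tight) same-support stratum of every matrix multiplication tensor, not only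
  at `⟨n,n,n⟩`;
* `summit_iff_exists_sameSupport_asymptoticRank_le_sq` — **`ω = 2 ⟺ ∃ t, supp t = supp ⟨n,n,n⟩ ∧
  R̃(t) ≤ n²`** (`⟹` with `t = ⟨n,n,n⟩`, `R̃(⟨n,n,n⟩) = n^ω`).

The level `n = 2` in the route's coordinates (the weighted stars `𝔖^w = weightedStar K 2 1 w`,
`w` nowhere zero, have exactly the support of `⟨2,2,2⟩` under the leaf relabelling `leafMM`:
`weightedStar_ne_zero_iff`, `sameSupport_starMM`):

* `summit_of_asymptoticRank_weightedStar_le_four` — **`R̃(𝔖^w) ≤ 4 ⟹ ω = 2`** for every nowhere-zero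
  weight table `w`; instances `summit_of_asymptoticRank_signStar_le_four` (`𝔖^♭`),
  `summit_of_asymptoticRank_fam_le_four` (`𝔖(q)`, `q ≠ 0`); quantitatively
  `omega_le_of_asymptoticRank_weightedStar_le : R̃(𝔖^w) ≤ 2^τ ⟹ ω ≤ (3τ − 2)/2`;
* `summit_iff_exists_flat_weightedStar` — **`ω = 2 ⟺ ∃ w nowhere zero, R̃(𝔖^w) ≤ 4`**, and
  `not_summit_iff_forall_four_lt` — **`ω > 2 ⟺ 4 < R̃(𝔖^w)` for ALL nowhere-zero `w`**: in the
  special-vs-generic dichotomy the generic members are not escape hatches — under `ω > 2` every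
  member of the stratum, special or generic, is a `4 × 4 × 4` counterexample to the asymptotic rank
  conjecture, and `ω = 2` as soon as ONE member (equivalently the special one) is flat.

References: H. Cohn, C. Umans, *Fast matrix multiplication using coherent configurations*,
SODA 2013, Def. 1, Def. 4, Prop. 5, Thm. 6 [CohnUmans2013] (arXiv:1207.6528);
M. Bläser, M. Christandl, J. Zuiddam, *The border support rank of two-by-two matrix
multiplication is seven*, Chicago J. Theoret. Comput. Sci. 2018 [BlaserChristandlZuiddam2017]
(arXiv:1705.09652, §2); A. Conner, F. Gesmundo, J. M. Landsberg, E. Ventura, Y. Wang, *Towards a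
geometric approach to Strassen's asymptotic rank conjecture*, Collect. Math. 72 (2021), Conj. 1.4
[ConnerGesmundoLandsbergVenturaWang2020]; M. Christandl, P. Vrana, J. Zuiddam, *Universal points
in the asymptotic spectrum of tensors*, J. AMS 36 (2023), §1.1 [ChristandlVranaZuiddam2023].
-/

noncomputable section

open scoped BigOperators

set_option linter.dupNamespace false

namespace Summit.MatrixMultiplication.MatrixMultiplication.Theorems.FarEdgeDescentSupportStratumDoor

open Literature.Computability.AlgebraicComplexity
open Literature.Barriers.MatrixMultiplication (asymptoticRank_le_of_polyDegeneratesTo)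
open Summit.MatrixMultiplication.MatrixMultiplication.Theorems.FarEdgeDescentSignTwist
open Summit.MatrixMultiplication.MatrixMultiplication.Theorems.FarEdgeDescentSignStarSRank
open Summit.MatrixMultiplication.MatrixMultiplication.Theorems.FarEdgeDescentWeightFamily

universe u

/-! ## 1. `SameSupport` under relabelling and Kronecker powers -/

section SameSupportAPI

variable {K : Type u} [Field K] {ι κ μ ι' κ' μ' : Type}

/-- `SameSupport` is stable under a common relabelling of the three index sets. [cite: CohnUmans2013, Def. 1] -/
theorem sameSupport_precomp {s t : ι → κ → μ → K} (h : SameSupport s t) (f : ι' → ι) (g : κ' → κ)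
    (e : μ' → μ) :
    SameSupport (fun a b c => s (f a) (g b) (e c)) (fun a b c => t (f a) (g b) (e c)) :=
  fun a b c => h (f a) (g b) (e c)

/-- **`SameSupport` is stable under Kronecker powers followed by a common relabelling**
(`supp s = supp t ⟹ supp s^{⊠N} = supp t^{⊠N}`: an entry of the power is a product of `N` entries and
a field has no zero divisors — the tree's `SupportRankDoor.sameSupport_kroneckerPow`, inlined to keep
this file's imports small). [cite: CohnUmans2013, Def. 1] -/
theorem sameSupport_kroneckerPow_precomp [Fintype ι] [Fintype κ] [Fintype μ] {s t : ι → κ → μ → K}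
    (h : SameSupport s t) (N : ℕ) (f : ι' → (Fin N → ι)) (g : κ' → (Fin N → κ))
    (e : μ' → (Fin N → μ)) :
    SameSupport (fun a b c => kroneckerPow s N (f a) (g b) (e c))
      (fun a b c => kroneckerPow t N (f a) (g b) (e c)) := by
  refine sameSupport_precomp (fun x y z => ?_) f g e
  simp only [kroneckerPow_apply, ne_eq, Finset.prod_eq_zero_iff, Finset.mem_univ, true_and,
    not_exists]
  exact forall_congr' fun i => by simpa only [ne_eq] using h (x i) (y i) (z i)

end SameSupportAPI

/-! ## 2. The power of a same-support tensor in the format of `⟨n^N, n^N, n^N⟩` -/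

section PowMM

variable {K : Type u} [Field K]

/-- Un-flattening of a pair index `Fin n^N × Fin n^N ≃ (Fin N → Fin n × Fin n)`. [folklore] -/
def pairIdx (n N : ℕ) : (Fin (n ^ N) × Fin (n ^ N)) ≃ (Fin N → Fin n × Fin n) where
  toFun p i := ((finFunctionFinEquiv.symm p.1) i, (finFunctionFinEquiv.symm p.2) i)
  invFun f := (finFunctionFinEquiv (fun i => (f i).1), finFunctionFinEquiv (fun i => (f i).2))
  left_inv p := by simp
  right_inv f := by
    funext i
    simp

/-- `pairIdx` unfolded. [folklore] -/
theorem pairIdx_apply (n N : ℕ) (p : Fin (n ^ N) × Fin (n ^ N)) :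
    pairIdx n N p = fun i => ((finFunctionFinEquiv.symm p.1) i, (finFunctionFinEquiv.symm p.2) i) :=
  rfl

/-- **`t^{⊠N}` in the format of `⟨n^N,n^N,n^N⟩`** (relabelled along `pairIdx`). [folklore] -/
def powMM (n N : ℕ) (t : (Fin n × Fin n) → (Fin n × Fin n) → (Fin n × Fin n) → K) :
    (Fin (n ^ N) × Fin (n ^ N)) → (Fin (n ^ N) × Fin (n ^ N)) → (Fin (n ^ N) × Fin (n ^ N)) → K :=
  fun a b c => kroneckerPow t N (pairIdx n N a) (pairIdx n N b) (pairIdx n N c)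

/-- The relabelling does not change the rank: `R(powMM n N t) = R(t^{⊠N})`. [cite: Blaser2013, Lemma 5.4] -/
theorem tensorRank_powMM (n N : ℕ) (t : (Fin n × Fin n) → (Fin n × Fin n) → (Fin n × Fin n) → K) :
    tensorRank (powMM n N t) = tensorRank (kroneckerPow t N) :=
  tensorRank_reindex (pairIdx n N) (pairIdx n N) (pairIdx n N) (kroneckerPow t N)

/-- **`supp t = supp ⟨n,n,n⟩ ⟹ supp (powMM n N t) = supp ⟨n^N,n^N,n^N⟩`** (`⟨n,n,n⟩^{⊠N} ≅ ⟨n^N,n^N,n^N⟩`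
along the same relabelling, tree `matMulTensor_pow_eq_kroneckerPow_comp`). [cite: CohnUmans2013, Def. 1] -/
theorem sameSupport_powMM {n : ℕ} {t : (Fin n × Fin n) → (Fin n × Fin n) → (Fin n × Fin n) → K}
    (h : SameSupport (matMulTensor K n n n) t) (N : ℕ) :
    SameSupport (matMulTensor K (n ^ N) (n ^ N) (n ^ N)) (powMM n N t) := by
  rw [matMulTensor_pow_eq_kroneckerPow_comp K n n n N]
  exact sameSupport_kroneckerPow_precomp h N _ _ _

end PowMM

/-! ## 3. The door on the same-support stratum of `⟨n,n,n⟩` -/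

section Door

/-- **Finite form.** If `t` has the support of `⟨n,n,n⟩` (`n ≥ 2`) and `R(t^{⊠N}) ≤ (n^N)^{2+ε}` for
some `N ≥ 1`, then `ω ≤ 2 + 3ε/2`: the power has the support of `⟨n^N,n^N,n^N⟩`, so
`R_s(⟨n^N,n^N,n^N⟩) ≤ (n^N)^{2+ε}`, and Cohn–Umans Prop. 5 + Thm. 6 (both proved in the tree) give the
bound (`SupportRank.omega_le_of_sameSupport_rank_le`). [cite: CohnUmans2013, Prop. 5, Thm. 6] -/
theorem omega_le_of_sameSupport_pow_rank_le {n : ℕ} (hn : 2 ≤ n)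
    {t : (Fin n × Fin n) → (Fin n × Fin n) → (Fin n × Fin n) → ℂ}
    (hst : SameSupport (matMulTensor ℂ n n n) t) {N : ℕ} (hN : 1 ≤ N) {ε : ℝ}
    (h : (tensorRank (kroneckerPow t N) : ℝ) ≤ ((n : ℝ) ^ N) ^ (2 + ε)) :
    omega ℂ ≤ 2 + 3 / 2 * ε := by
  have hnN : 2 ≤ n ^ N := le_trans hn (Nat.le_self_pow (by omega) n)
  refine omega_le_of_sameSupport_rank_le CohnUmans2013_prop_5_holds CohnUmans2013_thm_6_holds hnN
    ⟨powMM n N t, sameSupport_powMM hst N, ?_⟩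
  rw [tensorRank_powMM]
  push_cast
  exact h

/-- **Asymptotic form.** `supp t = supp ⟨n,n,n⟩` (`n ≥ 2`) and `R̃(t) ≤ n^τ` imply `ω ≤ (3τ − 2)/2`
(for every `δ > 0` some power has `R(t^{⊠M}) ≤ (n^{τ+δ})^M = (n^M)^{2 + (τ + δ − 2)}`). [cite: CohnUmans2013, Prop. 5, Thm. 6] -/
theorem omega_le_of_sameSupport_asymptoticRank_le {n : ℕ} (hn : 2 ≤ n)
    {t : (Fin n × Fin n) → (Fin n × Fin n) → (Fin n × Fin n) → ℂ}
    (hst : SameSupport (matMulTensor ℂ n n n) t) {τ : ℝ} (h : asymptoticRank t ≤ (n : ℝ) ^ τ) :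
    omega ℂ ≤ (3 * τ - 2) / 2 := by
  have hn0 : (0 : ℝ) < n := by exact_mod_cast (by omega : 0 < n)
  have hn1 : (1 : ℝ) < n := by exact_mod_cast (by omega : 1 < n)
  refine le_of_forall_pos_le_add fun δ' hδ' => ?_
  -- a margin `δ` in the exponent
  set δ : ℝ := 2 / 3 * δ' with hδ
  have hδ0 : 0 < δ := by rw [hδ]; positivity
  have hlt : asymptoticRank t < (n : ℝ) ^ (τ + δ) :=
    lt_of_le_of_lt h (Real.rpow_lt_rpow_of_exponent_lt hn1 (by linarith))
  -- `R̃(t) < r` is witnessed by a power: `R(t^{⊠M}) < r^M` for some `M ≥ 1` (definition of `R̃` as an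
  -- infimum of `M`-th roots; the tree's `exists_tensorRank_kroneckerPow_lt_of_asymptoticRank_lt`, inlined)
  obtain ⟨M, hM, hR⟩ : ∃ M : ℕ, 1 ≤ M ∧
      (tensorRank (kroneckerPow t M) : ℝ) ≤ ((n : ℝ) ^ (τ + δ)) ^ M := by
    have h' : (⨅ N : ℕ, ((tensorRank (kroneckerPow t (N + 1)) : ℝ) ^ ((N : ℝ) + 1)⁻¹)) <
        (n : ℝ) ^ (τ + δ) := hlt
    obtain ⟨N, hN⟩ := exists_lt_of_ciInf_lt h'
    refine ⟨N + 1, Nat.succ_pos N, le_of_lt ?_⟩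
    have hx : 0 ≤ (tensorRank (kroneckerPow t (N + 1)) : ℝ) := Nat.cast_nonneg _
    have hroot : 0 ≤ ((tensorRank (kroneckerPow t (N + 1)) : ℝ) ^ ((N : ℝ) + 1)⁻¹) := by
      positivity
    calc (tensorRank (kroneckerPow t (N + 1)) : ℝ)
        = ((tensorRank (kroneckerPow t (N + 1)) : ℝ) ^ ((N : ℝ) + 1)⁻¹) ^ (N + 1) := by
          rw [show ((N : ℝ) + 1) = ((N + 1 : ℕ) : ℝ) by push_cast; ring]
          exact (Real.rpow_inv_natCast_pow hx (Nat.succ_ne_zero N)).symm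
      _ < ((n : ℝ) ^ (τ + δ)) ^ (N + 1) := pow_lt_pow_left₀ hN hroot (Nat.succ_ne_zero N)
  have hexp : ((n : ℝ) ^ (τ + δ)) ^ M = ((n : ℝ) ^ M) ^ (2 + (τ + δ - 2)) := by
    rw [← Real.rpow_natCast ((n : ℝ) ^ (τ + δ)) M, ← Real.rpow_mul hn0.le,
      ← Real.rpow_natCast (n : ℝ) M, ← Real.rpow_mul hn0.le]
    congr 1
    ring
  rw [hexp] at hR
  have hω := omega_le_of_sameSupport_pow_rank_le hn hst hM hR
  rw [hδ] at hω
  linarith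

/-- **`R̃(t) ≤ n²` for one tensor `t` with the support of `⟨n,n,n⟩` (`n ≥ 2`) gives `ω(ℂ) = 2`.** [cite: CohnUmans2013, Prop. 5, Thm. 6] -/
theorem omega_eq_two_of_sameSupport_asymptoticRank_le_sq {n : ℕ} (hn : 2 ≤ n)
    {t : (Fin n × Fin n) → (Fin n × Fin n) → (Fin n × Fin n) → ℂ}
    (hst : SameSupport (matMulTensor ℂ n n n) t) (h : asymptoticRank t ≤ (n : ℝ) ^ 2) :
    omega ℂ = 2 := by
  have h' : asymptoticRank t ≤ (n : ℝ) ^ (2 : ℝ) := by rwa [Real.rpow_two]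
  have hω := omega_le_of_sameSupport_asymptoticRank_le hn hst h'
  norm_num at hω
  exact le_antisymm hω (omega_two_le ℂ)

/-- The same, concluding the summit statement `MatrixMultiplication` by name. [cite: CohnUmans2013, Prop. 5, Thm. 6] -/
theorem summit_of_sameSupport_asymptoticRank_le_sq {n : ℕ} (hn : 2 ≤ n)
    {t : (Fin n × Fin n) → (Fin n × Fin n) → (Fin n × Fin n) → ℂ}
    (hst : SameSupport (matMulTensor ℂ n n n) t) (h : asymptoticRank t ≤ (n : ℝ) ^ 2) :
    _root_.MatrixMultiplication :=
  (_root_.MatrixMultiplication_iff).2 (omega_eq_two_of_sameSupport_asymptoticRank_le_sq hn hst h)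

/-- **Contrapositive: `ω > 2 ⟹ R̃(t) > n²` for EVERY `t` with the support of `⟨n,n,n⟩` (`n ≥ 2`)** —
under `ω > 2` the asymptotic rank conjecture fails on the whole same-support stratum of every matrix
multiplication tensor. [cite: ConnerGesmundoLandsbergVenturaWang2020, Conj. 1.4] -/
theorem sq_lt_asymptoticRank_of_not_summit (hS : ¬ _root_.MatrixMultiplication) {n : ℕ} (hn : 2 ≤ n)
    {t : (Fin n × Fin n) → (Fin n × Fin n) → (Fin n × Fin n) → ℂ}
    (hst : SameSupport (matMulTensor ℂ n n n) t) : (n : ℝ) ^ 2 < asymptoticRank t :=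
  lt_of_not_ge fun h => hS (summit_of_sameSupport_asymptoticRank_le_sq hn hst h)

/-- **`ω = 2 ⟺` some tensor with the support of `⟨n,n,n⟩` has `R̃ ≤ n²`** (`n ≥ 2`; `⟹` with
`t = ⟨n,n,n⟩` itself, `R̃(⟨n,n,n⟩) = n^ω`). [cite: CohnUmans2013, Thm. 6] -/
theorem summit_iff_exists_sameSupport_asymptoticRank_le_sq {n : ℕ} (hn : 2 ≤ n) :
    _root_.MatrixMultiplication ↔
      ∃ t : (Fin n × Fin n) → (Fin n × Fin n) → (Fin n × Fin n) → ℂ,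
        SameSupport (matMulTensor ℂ n n n) t ∧ asymptoticRank t ≤ (n : ℝ) ^ 2 := by
  refine ⟨fun hS => ⟨matMulTensor ℂ n n n, SameSupport.refl _, ?_⟩,
    fun ⟨t, hst, h⟩ => summit_of_sameSupport_asymptoticRank_le_sq hn hst h⟩
  have hω : omega ℂ = 2 := (_root_.MatrixMultiplication_iff).1 hS
  rw [asymptoticRank_matMulTensor ℂ n (by omega), hω, Real.rpow_two]

end Door

/-! ## 4. Level `n = 2` in the route's coordinates: the weighted stars `𝔖^w` -/

section Stars

variable (K : Type u) [Field K]

/-- **A nowhere-zero weighted star `𝔖^w = weightedStar K 2 1 w` has exactly the support of `⟨2,2,2⟩`**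
under the leaf relabelling `leafMM` (Bläser–Christandl–Zuiddam's torus normal form of the
same-support stratum of `⟨2,2,2⟩`, in two-leaf coordinates). [cite: BlaserChristandlZuiddam2017, §2] -/
theorem weightedStar_ne_zero_iff {w : Fin 2 × Fin 2 → K} (hw : ∀ b, w b ≠ 0) (a : Leaf)
    (x : Fin 2 × Fin 2) (c : Leaf) :
    weightedStar K 2 1 w a x c ≠ 0 ↔ matMulTensor K 2 2 2 (leafMM a) x (leafMM c) ≠ 0 := by
  obtain ⟨x₁, x₂⟩ := x
  rcases a with ⟨i, l⟩ | ⟨i, l⟩ <;> rcases c with ⟨k, l'⟩ | ⟨k, l'⟩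
  · rw [weightedStar_inl_inl, leafMM_inl, leafMM_inl]
    fin_cases i <;> fin_cases k <;> fin_cases x₁ <;> fin_cases x₂ <;> fin_cases l <;>
      fin_cases l' <;> simp [matMulTensor]
  · simp [matMulTensor]
  · simp [matMulTensor]
  · rw [weightedStar_inr_inr, leafMM_inr, leafMM_inr, mul_ne_zero_iff, and_iff_right (hw _)]
    fin_cases i <;> fin_cases k <;> fin_cases x₁ <;> fin_cases x₂ <;> fin_cases l <;>
      fin_cases l' <;> simp [matMulTensor]

/-- **`𝔖^w` in the format of `⟨2,2,2⟩`** (leaves relabelled by `leafMM`). [folklore] -/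
def starMM (w : Fin 2 × Fin 2 → K) :
    (Fin 2 × Fin 2) → (Fin 2 × Fin 2) → (Fin 2 × Fin 2) → K :=
  fun a b c => weightedStar K 2 1 w (leafMM.symm a) b (leafMM.symm c)

/-- `supp (starMM w) = supp ⟨2,2,2⟩` for `w` nowhere zero. [cite: BlaserChristandlZuiddam2017, §2] -/
theorem sameSupport_starMM {w : Fin 2 × Fin 2 → K} (hw : ∀ b, w b ≠ 0) :
    SameSupport (matMulTensor K 2 2 2) (starMM K w) := by
  intro a b c
  simpa [starMM] using (weightedStar_ne_zero_iff K hw (leafMM.symm a) b (leafMM.symm c)).symm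

/-- **The unit-weight star IS `⟨2,2,2⟩`** in this format: `starMM 1 = ⟨2,2,2⟩` (the special member of
the stratum). [folklore] -/
theorem starMM_one : starMM K (fun _ => 1) = matMulTensor K 2 2 2 := by
  funext a b c
  obtain ⟨i, l⟩ := a
  obtain ⟨b₁, b₂⟩ := b
  obtain ⟨k, l'⟩ := c
  fin_cases i <;> fin_cases l <;> fin_cases b₁ <;> fin_cases b₂ <;> fin_cases k <;> fin_cases l' <;>
    simp [starMM, leafMM, weightedStar, matMulTensor]

/-- The relabelling does not change the asymptotic rank: `R̃(starMM w) = R̃(𝔖^w)`. [cite: Blaser2013, Lemma 5.4] -/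
theorem asymptoticRank_starMM (w : Fin 2 × Fin 2 → K) :
    asymptoticRank (starMM K w) = asymptoticRank (weightedStar K 2 1 w) :=
  -- `starMM w` is definitionally the relabelling of `𝔖^w` along `(leafMM⁻¹, id, leafMM⁻¹)`; `R̃` is
  -- invariant under relabelling (restriction both ways — the tree's `asymptoticRank_reindex`, inlined)
  show asymptoticRank (fun a b c => weightedStar K 2 1 w (leafMM.symm a) ((Equiv.refl _) b)
      (leafMM.symm c)) = _ from
    le_antisymm
      (asymptoticRank_le_of_polyDegeneratesTo
        (tensorRestrictsTo_precomp (weightedStar K 2 1 w) leafMM.symm (Equiv.refl _)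
          leafMM.symm).polyDegeneratesTo)
      (asymptoticRank_le_of_polyDegeneratesTo
        (tensorRestrictsTo_of_reindex (weightedStar K 2 1 w) leafMM.symm (Equiv.refl _)
          leafMM.symm).polyDegeneratesTo)

end Stars

section StarDoor

/-- **`R̃(𝔖^w) ≤ 2^τ ⟹ ω ≤ (3τ − 2)/2`** for every nowhere-zero weight table `w`. [cite: CohnUmans2013, Prop. 5, Thm. 6] -/
theorem omega_le_of_asymptoticRank_weightedStar_le {w : Fin 2 × Fin 2 → ℂ} (hw : ∀ b, w b ≠ 0)
    {τ : ℝ} (h : asymptoticRank (weightedStar ℂ 2 1 w) ≤ (2 : ℝ) ^ τ) :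
    omega ℂ ≤ (3 * τ - 2) / 2 :=
  omega_le_of_sameSupport_asymptoticRank_le (n := 2) le_rfl (sameSupport_starMM ℂ hw)
    (by rw [asymptoticRank_starMM]; exact_mod_cast h)

/-- **`R̃(𝔖^w) ≤ 4 ⟹ ω = 2`** for every nowhere-zero weight table `w`: each member of the
same-support stratum of `⟨2,2,2⟩`, special (`w ≡ 1`) or generic, is a door to the summit. [cite: CohnUmans2013, Prop. 5, Thm. 6] -/
theorem summit_of_asymptoticRank_weightedStar_le_four {w : Fin 2 × Fin 2 → ℂ} (hw : ∀ b, w b ≠ 0)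
    (h : asymptoticRank (weightedStar ℂ 2 1 w) ≤ 4) : _root_.MatrixMultiplication :=
  summit_of_sameSupport_asymptoticRank_le_sq (n := 2) le_rfl (sameSupport_starMM ℂ hw)
    (by rw [asymptoticRank_starMM]; norm_num; exact h)

/-- **`ω > 2 ⟹ 4 < R̃(𝔖^w)`** for every nowhere-zero `w`. [cite: ConnerGesmundoLandsbergVenturaWang2020, Conj. 1.4] -/
theorem four_lt_asymptoticRank_weightedStar_of_not_summit (hS : ¬ _root_.MatrixMultiplication)
    {w : Fin 2 × Fin 2 → ℂ} (hw : ∀ b, w b ≠ 0) : 4 < asymptoticRank (weightedStar ℂ 2 1 w) :=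
  lt_of_not_ge fun h => hS (summit_of_asymptoticRank_weightedStar_le_four hw h)

/-- **The sign star is a door: `R̃(𝔖^♭) ≤ 4 ⟹ ω = 2`.** [cite: BlaserChristandlZuiddam2017, Def. 5] -/
theorem summit_of_asymptoticRank_signStar_le_four (h : asymptoticRank (signStar ℂ) ≤ 4) :
    _root_.MatrixMultiplication :=
  summit_of_asymptoticRank_weightedStar_le_four (sgnWeight_ne_zero (K := ℂ)) h

/-- **Every member `𝔖(q)`, `q ≠ 0`, of the one-parameter family is a door: `R̃(𝔖(q)) ≤ 4 ⟹ ω = 2`.** [cite: BlaserChristandlZuiddam2017, §2] -/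
theorem summit_of_asymptoticRank_fam_le_four {q : ℂ} (hq : q ≠ 0)
    (h : asymptoticRank (fam ℂ q) ≤ 4) : _root_.MatrixMultiplication :=
  summit_of_asymptoticRank_weightedStar_le_four (w := famW ℂ q)
    (fun b => by unfold famW; split_ifs <;> simp [hq]) h

/-- `R̃(𝔖^1) = R̃(⟨2,2,2⟩) = 2^ω`: the special member. [cite: AlmanDuanVassilevskaWilliamsXuXuZhou2025, §3.4] -/
theorem asymptoticRank_weightedStar_one :
    asymptoticRank (weightedStar ℂ 2 1 (fun _ => 1)) = (2 : ℝ) ^ omega ℂ := by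
  rw [← asymptoticRank_starMM, starMM_one, asymptoticRank_matMulTensor ℂ 2 (by norm_num)]
  norm_num

/-- **`ω = 2 ⟺ ∃ w` nowhere zero with `R̃(𝔖^w) ≤ 4`** (`⟹`: the special member `w ≡ 1` has
`R̃ = 2^ω = 4`; `⟸`: the door). [cite: CohnUmans2013, Thm. 6] -/
theorem summit_iff_exists_flat_weightedStar :
    _root_.MatrixMultiplication ↔
      ∃ w : Fin 2 × Fin 2 → ℂ, (∀ b, w b ≠ 0) ∧ asymptoticRank (weightedStar ℂ 2 1 w) ≤ 4 := by
  refine ⟨fun hS => ⟨fun _ => 1, fun _ => one_ne_zero, ?_⟩,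
    fun ⟨w, hw, h⟩ => summit_of_asymptoticRank_weightedStar_le_four hw h⟩
  have hω : omega ℂ = 2 := (_root_.MatrixMultiplication_iff).1 hS
  rw [asymptoticRank_weightedStar_one, hω]
  norm_num

/-- **`ω > 2 ⟺ 4 < R̃(𝔖^w)` for ALL nowhere-zero `w`**: the generic members of the stratum are not
escape hatches. [cite: ConnerGesmundoLandsbergVenturaWang2020, Conj. 1.4] -/
theorem not_summit_iff_forall_four_lt :
    ¬ _root_.MatrixMultiplication ↔
      ∀ w : Fin 2 × Fin 2 → ℂ, (∀ b, w b ≠ 0) → 4 < asymptoticRank (weightedStar ℂ 2 1 w) := by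
  rw [summit_iff_exists_flat_weightedStar]
  push Not
  rfl

end StarDoor

end Summit.MatrixMultiplication.MatrixMultiplication.Theorems.FarEdgeDescentSupportStratumDoor

end
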